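import Mathlib
import HarnessLib
import HarnessLib.Audit
import Summits.RiemannHypothesis.Statement
import Summits.RiemannHypothesis.RiemannHypothesis.Theorems.LiTailLaguerreDefs
import Summits.RiemannHypothesis.RiemannHypothesis.Theorems.LiPrimeEchoDefs
import Literature.NumberTheory.LFunctions.Equivalents
import Literature.Analysis.SpecialFunctions.LaguerreLaplaceTransform
import HarnessLib.Audit.Status.Attr

/-!
Route: LiTailLaguerre

CLOSED (proved) 2026-08-26T20:03:50Z by operator:999:545382 — reason: proved:Summit.RiemannHypothesis.RiemannHypothesis.Theorems.LiTheory.liZeroTailLaguerre_proof — note: round 7: binders p463815 p457510 p459431 p459219 p459617 CLOSED·proved; capstone p464718 liZeroTailLaguerre_proof := Theses.LiTailLaguerre.closes; BC5 p461299; tribunal T1/T2/J replayed 19:44Z; director-rh g6 T7; nothing here bears on the truth of RH. The file is kept as the record of this route; refuted decls are indexed as negative knowledge (`ledger negatives`).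

# Route LiTailLaguerre — RH-free Li tail–Laguerre law — the zeros above height c√n, Li-weighted,
minus their Riemann–von Mangoldt mean, equal minus the exact Laguerre terms of the prime powers
below e^{1/c²}

Column LI of the RH ladder (D-0040/D-0059/D-0061), theory round 7: the route closes the RUNG LEAF
«Li TAIL–LAGUERRE LAW»
`LiTheory.LiZeroTailLaguerre` (registered closer, rung L-P(P1-tail); RH-FREE for all n,
PROOF-OF-DATA, NOT height-buying):
for every fixed c > 0 with log m ≠ 1/c² for all prime powers m there is C_c with, for all n ≥ 2,
|liZeroTail n (c√n) − liSmoothTail n (c√n) + Σ_{2 ≤ m ≤ ⌊e^{1/c²}⌋} liCoffeyTerm m n| ≤ C_c log² n,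
where liZeroTail n T =
λ_n − Re Σ_{ρ ∈ liZeroBox T} m_ρ(1 − (1 − 1/ρ)ⁿ) is the Li-weighted sum over the zeros ABOVE height
T (via Bombieri–Lagarias,
every zero whatever its real part), liSmoothTail n T = (2/π)∫_T^∞ (1 − cos nθ(t)) ϑ′(t) dt its
Riemann–von Mangoldt mean, and
liCoffeyTerm m n = (Λ(m)/m)·L¹_{n−1}(log m) the term of m in the Bombieri–Lagarias/Coffey arithmetic
formula for λ_n
(PROVED in tree, `Coffey2005_thm1_holds`).  It suffices to show X = LiTailContour ∧
LiPrimeTailLaguerre ∧ LiGammaTailShift ∧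
LiTailHorizontal (+ the Assembly item, PROVED in the dossier sketch from two support statements):
the Bombieri rectangle of the
proved window law (route LiPrimeEcho) becomes the HALF-STRIP [−1/2, 3/2] × [T, ∞) with the CO-WEIGHT
2 − k_n(w) (O(n²/|w|²) at the
top, so the top edge vanishes and every edge integral converges absolutely); the gamma piece shifted
to the critical line IS
liSmoothTail, the horizontal edge at a good height is O(log² n), and in the prime piece every
RELEASED prime power m
(log m < 1/c², stationary height √(n/log m) above the cut) is shifted to Re w = ½ where the complete
integral is the exact
LAGUERRE BRIDGE ∫_0^∞ 2(1 − cos nθ(t)) cos(t log m) dt = π m^{−1/2} L¹_{n−1}(log m), while the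
missing [0, T] piece and every
non-released m are non-stationary — no stationary-phase evaluation anywhere.
Lean: `Summit.RiemannHypothesis.RiemannHypothesis.Theorems.LiTheory.LiZeroTailLaguerre`

## Assembly
K1′ at the good height T′ ∈ [c√n, c√n + 1] supplied by K4′ writes liZeroTail n T′ as polar + gamma −
prime + horizontal; the
polar piece is O(log n) (support statement LiPolarTailBound: |1/w + 1/(w − 1)| ≤ 2/y against the
bounded co-weight on [T, n] and
O(n²/y²) beyond), gamma − smooth is O(log n) (K3′), prime − Σ liCoffeyTerm is O(log n) (K2′), the
horizontal edge is O(log² n)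
(K4′), and moving the cut from c√n to T′ costs O(log n) on liZeroTail and liSmoothTail (support
LiTailAdjust: ≤ O(log n) zeros in
a unit window by Riemann–von Mangoldt, each with |Re m(1 − zⁿ)| ≤ m(1 + e^{1/(2c²)}) at ANY real
part; ϑ′(t) ≤ ½ log t); "for
all large n" becomes "for all n ≥ 2" with a worse constant (finitely many n).  Every sign and
constant of this composition is
kernel-checked: `liZeroTailLaguerre_of` / `assembly_of_supports` in HOME/theory/route/r7/Sketch.lean
(farm rc 0, 0 sorries);
the two support statements are the stubs of the Assembly's registered skeleton (not items; provers
land them `--supports`).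

CLOSES_TARGET: closes rung L-P(P1-tail) of RiemannHypothesis: Summit.RiemannHypothesis.RiemannHypothesis.Theorems.LiTheory.LiZeroTailLaguerre (D-0061; not the summit Statement) — the deciding theorem of this route concludes that registered leaf instead of the Statement decl `RiemannHypothesis` (class rung: servable and labelled, never counted as concluding the summit Statement).

Rationale: WHY THIS LINE. Rung L-P(P1e) (route LiPrimeEcho, CLOSED·proved 2026-08-26) proved the WINDOW law:
the zeros between √n and c√n (c ≥ 5/4) carry
the chirp −A₂ n^{1/4} cos(2√(n log 2) + π/4) of the prime 2, by Bombieri's rectangle and a sharp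
weighted stationary phase.  The
new line takes the COMPLEMENT — the zeros ABOVE the cut — where three things improve at once: (i)
the main terms become EXACT
special functions, (Λ(m)/m)L¹_{n−1}(log m), i.e. literally the terms of the arithmetic formula
(Bombieri–Lagarias 1999 Thm 2 /
Coffey 2005 Thm 1, eqs. (10)–(12), (122): L¹_{n−1} as an inverse Laplace transform), so the
statement says WHICH PART OF THE
EXPLICIT FORMULA THE HIGH ZEROS CARRY: exactly the prime powers m < e^{n/T²}; (ii) the deciding
estimate needs NO stationary
phase — the released terms are evaluated by Cauchy's theorem and the bridge identity, the rest by
the first-derivative test;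
(iii) the window law, its multi-prime version T3e and the tail silence/echo statements (ET2 data,
DATA.md §H) all follow by
differencing two cuts plus Fejér's classical Laguerre asymptotic (companions typed in PART K with
PROVED glue).  Imported from
another area: classical orthogonal-polynomial analysis (Fejér 1909 / Perron 1921 / Szegő Thm 8.22.1
only for the companions;
the bridge identity is an exact Fourier-cosine transform).  The height ↔ prime-length duality x =
e^{n/T²} is the Li-kernel
analogue of the Landau–Gonek phenomenon (sums of x^ρ over zeros up to T detect prime powers; Gonek
1993) and of Voros's
detectability heuristic |Im ρ| ≲ √(n/2) (arXiv:math/0506326 §3).  DATA (certified inputs only): ET2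
kit j248301 (tail silence for
c ∈ {1.25,1.5,2,3}, full echo at c = 1); THE LAW ITSELF kit j255188 (six cuts c ∈
{1.0,1.07,0.90,0.80,0.752,0.66}, up to seven
released prime powers, 221 certified n ∈ [10³,10⁷]: residual band rms 0.8–2.2, growth exponent ≤
0.10 vs 0.25 for an n^{1/4}
law, while the subtracted Laguerre sums grow to 11–30); eng-4 g3's bridge check (45 pairs to 1e-8,
DATA.md N.12) and eng-4 g4's
prime-side staircase (kit j254850, N.13).  Sources: BombieriLagarias1999, Coffey2005LiCriterion
(paper:arxiv-math-ph_0505052),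
doi:10.1016/j.jat.2006.10.006, Lagarias2007LiCoefficients, Bombieri2000Weil, Gonek1993,
MontgomeryVaughan2007, arXiv:math/0506326.

RANKED CRUXES. #2 LiPrimeTailLaguerre (crux) — (K2′, deciding, RH-FREE) the PRIME TAIL equals the
released Laguerre terms: for every c > 0 off the resonances (log m ≠ 1/c² for prime powers m), large
n and every cut T ∈ [c√n, c√n + 1], |liPrimeTail n T − Σ_{2 ≤ m ≤ ⌊e^{1/c²}⌋} liCoffeyTerm m n| ≤ C
log n (true size O_c(1)): liPrimeTail = (1/π) Re Σ_m Λ(m) m^{−3/2} ∫_T^∞ m^{−iy}(2 − k_n(3/2+iy)) dy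
(sum/integral exchanged by absolute convergence, |2 − k_n| ≤ 3 + e^{1/c²} on [T, n], ≤ C n²/y²
beyond); a RELEASED m (finitely many) is moved by Cauchy on [½, 3/2] × [T, Y], Y → ∞, to the
critical line where 2 − k_n(½+iy) = 2(1 − cos nθ(y)) and Re ∫_0^∞ m^{−iy} 2(1 − cos nθ) dy = π
m^{−1/2} L¹_{n−1}(log m) (the bridge — IN THE KERNEL since 15:19Z:
`Literature.Analysis.SpecialFunctions.integral_liKernel_mul_cos_Ioi`, eng-4 g4 p451181/p454135, with
`laguerreCoeff_one` for liLaguerreOne n = L^{(1)}_{n−1}; support LiLaguerreBridge is its corollary),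
the connector at height T is O(m^{−1/2}(3 + e^{1/c²})) and the missing ∫_0^T is non-stationary
(phase y log m − nθ(y) has derivative ≤ −(n/(T² + ¼) − log m) < −gap_c on [0, T]); a NON-RELEASED m
stays on Re w = 3/2 where all three phases y log m, y log m ∓ arg F_n are monotone with |φ′| ≥
min(log m − 1/c², log 2) > 0, so the first-derivative test gives O(Λ(m) m^{−3/2}/gap_m), summable in
m. [difficulty: L] (why it might fail: the termwise pieces 2m^{−iy}, m^{−iy}F_n(w), m^{−iy}F_n(1−w)
converge only conditionally at ∞ (need bounds on [T,Y] uniform in Y); and the bridge normalisation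
(π e^{−y/2}, index n−1) must match liLaguerreOne exactly — a factor 2 or index shift leaves an
O(n^{1/4}) residual.) [BombieriLagarias1999, paper:arxiv-math-ph_0505052,
doi:10.1016/j.jat.2006.10.006, Coffey2010Eta, Bombieri2000Weil, Gonek1993,
tree:Literature/Analysis/SpecialFunctions/LaguerreLaplaceTransform.lean,
tree:Summits/RiemannHypothesis/RiemannHypothesis/Theorems/LiPrimeEchoLiPrimeEdgeEcho.lean,
tree:Literature/NumberTheory/LFunctions/WeilExplicitRightEdge.lean]
#3 LiTailContour (crux) — (K1′) the TAIL CONTOUR IDENTITY: for n ≥ 1 and a good height T ≥ 1 (no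
zero of ξ on [−1/2, 3/2] × {T}), liZeroTail n T = liPolarTail n T + liGammaTail n T − liPrimeTail n
T + liHorizTail n T — the PROVED window identity `LiWindowContour` (route LiPrimeEcho) at weights
F_0 = 1 and F_n on [−1/2, 3/2] × [T, Y] for good Y → ∞: Σ_{T<|Im ρ|≤Y} Re m(1 − z_ρⁿ) =
liZeroTraceWindow 0 T Y − liZeroTraceWindow n T Y = (edges with the co-weight 2 − k_n) + liHorizTail
n T − (top edge at Y); the zero side tends to liZeroTail n T by Bombieri–Lagarias
(`keiperLiCoeff_eq_zero_sum_holds`), the top edge is O(n log² Y / Y) → 0 along good heights (|1 −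
F_n(x + iY)| ≤ e n/Y for Y ≥ n, ∫|ξ′/ξ| dx ≤ C log² Y at a good height), and the three right-edge
integrals converge absolutely (co-weight O(n²/y²) beyond y ≍ n against 2/y, ½ log y, ζ′/ζ(3/2)).
[difficulty: M] (why it might fail: the Y → ∞ passage needs dominated convergence for three
Ioi-integrals whose co-weight decays only beyond y ≍ n (O(1) on [T, n]), good heights Y_k → ∞, and
the finsum bookkeeping Σ m(1 − zⁿ) = Σ m − Σ m zⁿ over liZeroBox; a sign slip in
liHorizTail/liPrimeTail makes it false as typed.) [BombieriLagarias1999, Bombieri2000Weil,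
MontgomeryVaughan2007,
tree:Summits/RiemannHypothesis/RiemannHypothesis/Theorems/LiPrimeEchoLiWindowContour.lean,
tree:Literature/NumberTheory/LFunctions/Equivalents.lean,
tree:Literature/NumberTheory/LFunctions/RiemannXiLogDeriv.lean]
#4 LiGammaTailShift (crux) — (K3′) the GAMMA TAIL IS THE SMOOTH TAIL up to O(log n): for c > 0,
large n and c√n ≤ T ≤ n, |liGammaTail n T − liSmoothTail n T| ≤ C log n — Cauchy on [½, 3/2] × [T,
Y] for the analytic integrand (−½ log π + ½ψ(w/2))(2 − k_n(w)) (no pole above height 1), Y → ∞ (top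
connector O(n² log Y/Y²)); on the critical line 2 − k_n(½ + it) = 2(1 − cos nθ(t)) (|1 − 1/s| = 1,
arg(1 − 1/s) = 2 arctan(1/2t) = liZeroAngle t) and Re(−½ log π + ½ψ(¼ + it/2)) = liGammaDensity t,
so the shifted integral IS liSmoothTail n T exactly; the connector at height T costs ≤ (½ log(T + 4)
+ 5)(3 + e^{1/c²}) = O(log n) (`norm_digamma_le_log_height`, |F_n(w)| ≤ 1 and |F_n(1 − w)| ≤
e^{n/T²} ≤ e^{1/c²} for Re w ≥ ½, Im w ≥ c√n).  A near-copy of the PROVED `LiGammaShift`.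
[difficulty: M] (why it might fail: low risk; the critical-line identifications are the PROVED ones
of LiGammaShift; new is the unbounded strip: integrability of ψ(w/2)(2 − k_n) ~ log y·n²/y² on Ioi T
on both lines and the vanishing top connector — an O(1/y) co-weight bound would NOT suffice.)
[Bombieri2000Weil, MontgomeryVaughan2007, Titchmarsh1986,
tree:Summits/RiemannHypothesis/RiemannHypothesis/Theorems/LiPrimeEchoLiGammaShift.lean,
tree:Literature/NumberTheory/LFunctions/WeilExplicitRightEdge.lean]
#5 LiTailHorizontal (crux) — (K4′) the BOTTOM EDGE at a good height: for c > 0, large n and every T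
∈ [c√n, n] there is a good height T′ ∈ [T, T + 1] with |liHorizTail n T′| ≤ C log² n — liHorizTail n
T′ = liHorizTerm 0 T′ − liHorizTerm n T′ (weights 1 and F_n), Montgomery–Vaughan Lemma 12.2 good
heights (`ExplicitPsi.exists_goodHeight_all`: separation η with 1/η ≤ 2 + log(T′ + 2)/c₀ from every
ordinate), the segment bound |ξ′/ξ(σ + iT′)| ≤ C₀ log(|T′| + 4)/η on σ ∈ [−1/2, 3/2]
(`exists_norm_logDeriv_riemannXi_le`), |F_n(σ + iT′)| ≤ (1 + 2/T′²)^{n/2} ≤ e^{1/c²} for σ ≥ −1/2,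
segment length 2.  A near-copy of the PROVED `LiHorizontalEdges` (there c ≥ 1, T ≤ c√n; here any c >
0 and T ≤ n, which only changes the constant e ↦ e^{1/c²} and log T ≤ log n). [difficulty: M] (why
it might fail: low risk — inputs are tree theorems; residual work is the interval-integrability of σ
↦ ξ′/ξ(σ + iT′)(1 − F_n(σ + iT′)) on the closed segment at a good height and the weight bound for σ
< 0 (|1 − 1/s|² ≤ 1 + 2/T′² needs σ ≥ −1/2).) [MontgomeryVaughan2007, Bombieri2000Weil,
tree:Summits/RiemannHypothesis/RiemannHypothesis/Theorems/LiPrimeEchoLiHorizontalEdges.lean,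
tree:Literature/NumberTheory/LFunctions/ExplicitFormulaPsiProofs.lean,
tree:Literature/NumberTheory/LFunctions/RiemannXiLogDeriv.lean]

TWO-LAYER PLAN. LiPrimeTailLaguerre ⇐ stub_released_shift (prime tail = Σ_released
(Λ(m)/(π√m))·bridgeInt n (log m) + O(log n): Cauchy shift of the released m, first-derivative test
for the rest) → stub_bridge_coffey ((Λ(m)/(π√m))·bridgeInt n (log m) = liCoffeyTerm m n, i.e. the
Laguerre bridge ∫_0^∞ 2(1 − cos nθ)cos(ty) dt = π e^{−y/2} L¹_{n−1}(y) — support LiLaguerreBridge =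
corollary of the tree theorem `integral_liKernel_mul_cos_Ioi` + `laguerreCoeff_one`, prover g5's
hand) → LiPrimeTailLaguerre (+ BC5 plan-only rung stub_rung_silent: c ≥ 5/4, no released term,
|liPrimeTail| ≤ C log n by the first-derivative test alone); LiTailContour ⇐ stub_tail_as_limit
(B–L: liZeroTail = lim_Y [liZeroTraceWindow 0 T Y − liZeroTraceWindow n T Y]) → stub_edges_limit
(window identity at weights 1 and F_n + absolute convergence + vanishing top edge along good Y_k →
∞); LiGammaTailShift ⇐ stub_gamma_critical (the shifted integral IS liSmoothTail) →
stub_gamma_connector (Cauchy + connector O(log n)); LiTailHorizontal ⇐ stub_horiz_split (liHorizTail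
= liHorizTerm 0 − liHorizTerm n at good heights) → stub_horiz_pair (one good height bounding both);
Assembly ⇐ stub LiPolarTailBound → stub LiTailAdjust (composition PROVED).  Nothing filed as
children now; compositions are PROVED in bc/<Item>_birth.lean.

KILL CRITERIA. A refutation of LiPrimeTailLaguerre at an admissible c (a certified n-range on which
|liPrimeTail n (c√n) − Σ liCoffeyTerm|/log n is unbounded — equivalently, by the PROVED-in-sketch
composition and the numerically exact K1′/K3′, an n-range where |R_L(n;c)|/n^{1/4} does not tend to
0) closes the route `refuted:LiPrimeTailLaguerre`; a normalisation refutation of the bridge (π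
e^{−y/2} L¹_{n−1} vs liLaguerreOne) forces a restate of liCoffeyTerm's companion reading, not of the
leaf (the leaf's Σ is over liCoffeyTerm as defined; data j255188 used exactly that normalisation).
A refutation of LiTailContour as typed (sign of liHorizTail or of the prime piece) is a MISSTATEMENT
repair (restate with the sign the window identity forces), not a death.  The leaf cannot be vacuous:
the edge hypothesis holds for every c outside the countable set {(log m)^{−1/2}}.

NOT DECOMPOSED YET. The interior of K2′ beyond its two stubs (uniform-in-Y boundedness of the three
oscillatory pieces per m; the gap bookkeeping min_m |log m − 1/c²| > 0 from the edge hypothesis;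
Tonelli for Σ_m ∫); dominated-convergence details of K1′; the elementary weight bounds |F_n(1 − w)|
≤ e^{n/|w−1|²}, |2 − k_n(w)| ≤ C n²/|w|² for |w| ≥ n, |1 − F_n(x + iY)| ≤ e n/Y (shared layer-2
lemmas, to be landed `--supports` by whoever needs them first); the Fejér asymptotic
LiCoffeyTermFejer (companion, NOT needed by the route).

CHEAPEST FALSIFIER. RUN (kit j255188, 2 c × 10 s, HOME/theory/route/r7/data/): R_L(n;c) =
D_tail(n;c) + Σ_{m ≤ e^{1/c²}} liCoffeyTerm m n over ET2's 221 certified n ∈ [10³, 10⁷] for six cuts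
c ∈ {1.0, 1.07, 0.90, 0.80, 0.752, 0.66} (released {2},{2},{2,3},{2,3,4},{2,3,4,5},{2,3,4,5,7,8,9}):
band rms 0.8–2.2 (3.3 top band at c = 0.80, 0.012 from the resonance c₅), max 4.8 (6.2), growth
exponents 0.103/0.009/0.039/−0.062/0.082/0.067 against 0.25 for any surviving n^{1/4} term, means
within ±0.7, while the subtracted sums grow 1.7→11 (c = 1) … 5.6→27.6 (c = 0.66); STEP-0: recomputed
D_tail(n;1) = ET2's certified ball to 3.2e-11 at every n.  The next cheapest kill is analytic: the n
= 1 bridge 4∫_0^∞ cos(ty)/(1 + 4t²) dt = π e^{−y/2} (checked by hand) and eng-4 g3's 45-pair check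
of the bridge to 1e-8.

NUMBERS. c_m = (log m)^{−1/2}: 1.2011 (m=2), 0.9542 (3), 0.8493 (4), 0.7884 (5), 0.7169 (7), 0.6934
(8), 0.6746 (9), 0.6458 (11).  Sample (j255188, c = 1, n = 10⁶, 868 zeros below the cut): D_tail =
+7.823, Σ liCoffeyTerm = −7.591, R_L = +0.232; (c = 0.66, n = 10⁶): +29.961, −30.414, −0.453.  A₂ =
0.36400 (liEchoAmp); Fejér: liCoffeyTerm m n = −liPrimeEcho m n + O_m(n^{−1/4}) (R_L − R_E ≤ 0.01 on
the grid).  Typed exponent log² n is generous (empirically O(1)); the honest analytic budget is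
O(log² n) from the horizontal edge and O(log n) from the cut adjustment.

DEFINITION REQUESTS. None: liLaguerreOne, liCoffeyTerm, liZeroTail, liSmoothTail, liCoSymWeight,
liPolarTail, liGammaTail, liPrimeTail, liHorizTail and the leaf are in PART K
`Theorems/LiTailLaguerreDefs.lean` (p451753 ACCEPTED, commit 929bba26e5f6).

Novelty: Searches (2026-08-26): lit search --hybrid "Li coefficients Laguerre polynomial sum over zeros
height truncation prime powers" (8 docs, all generic orthogonal-polynomial/textbook hits:
[corpus:book:ismail2005 p.224–228] Laguerre asymptotics only); lit vsearch "<the law in prose>" (-k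
8: [corpus:book:montgomery2007 p.206,139] explicit-formula pages, no Li kernel); lit search "Coffey
Li Laguerre" --source local ([corpus:paper:arxiv-math-ph_0505052 p.3] Coffey 2005 arithmetic
formula; [corpus:paper:doi-10-1016-j-jat-2006-10-006 p.1–9] Coffey 2007 theta–Laguerre calculus —
grep 'truncat|height|sum over zeros' finds only Gourdon's verification height, no height-truncated
zero sum); lit galaxy search "Li/Keiper constants|Keiper-Li coefficients|oscillations in Li's|Li
coefficients for the Riemann" --star all (5 rows: [galaxy:panama:519639503208515] Voros's book,
[galaxy:pdf:-2558283909540938720] Bllaca–Mazhouda–Nakamura quadrilateral zeta,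
Coffey/Connon/Blagouchine series papers — none on height truncation); lit galaxy search
"Landau-Gonek|Gonek's formula|Landau's formula for zeros" --star pdf (3 rows, moments of ζ′(ρ): the
classical x^ρ duality, not the Li kernel); round-6 searches (lit citing
doi:10.1016/j.jnt.2004.07.016, galaxy "Li's criterion|Li coefficients|Keiper-Li" 33 rows) re-read:
nothing on tails above a height.  Tree: `lean search liZeroTail|Laguerre` — only PART K and the
unrelated quadrature rule `Literature.Analysis.Quadrature.laguerreOne`.
Nearest prior art found: p  [refs: 10.1016/j.jnt.2004.07.016, 10.1016/j.jat.2006.10.006, math/0506326, book:ismail2005, book:montgomery2007, paper:arxiv-math-ph_0505052, paper:doi-10-1016-j-jat-2006-10-006, doi:10.1016/j.jnt.2004.07.016, doi:10.1016/j.jat.2006.10.006, BombieriLagarias1999, Gonek1993]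

Barriers (technique_class: explicit-formula contour, Laguerre bridge, 1st-deriv test): - technique_class: explicit-formula contour, Laguerre bridge, 1st-deriv test
- Literature.Barriers.RiemannHypothesis.BoundedFluctuationCounting: outside — no bounded-fluctuation
counting law is asserted; S(t) enters only through good-height log-derivative bounds (K4′) and the
Riemann–von Mangoldt unit-window count (LiTailAdjust), both with growing log factors, exactly as in
the PROVED LiPrimeEcho items [corpus: tree
Literature/Barriers/RiemannHypothesis/BoundedFluctuationCounting.lean].
- Literature.Barriers.RiemannHypothesis.LindelofBacklund / GramRosserFailures: outside — no size ⇒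
zero-free upgrade, no Gram/Rosser/Turing law; zeros enter with multiplicity at ANY real part in [0,
1] (weights bounded by e^{1/(2c²)} above the cut), the statement is RH-free by construction.
- Literature.Barriers.RiemannHypothesis.NymanBeurlingObstructions / MollifierLimitations /
BerryKeatingOperator / DeBrangesPositivity / JensenPolynomials / WeilPositivity-type: not this
route's class — the leaf is labelled NOT evidence for RH and NOT height-buying; it is an
identity-with-error between an RH-free zero functional and prime-power data, true or false
independently of RH (an off-line zero above c√n changes liZeroTail by a bounded amount already
inside the error; an off-line zero below c√n is not in the statement at all).
- Parity / explicit-formula truncation limits (uncertainty principle for the pair (T, x), "no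
termwise convergence of Σ_m on Re w = ½"): honoured, not beaten — only the finitely

History (route lifecycle, newest last):
- 2026-08-26T20:03:50Z · CLOSED proved — proved:Summit.RiemannHypothesis.RiemannHypothesis.Theorems.LiTheory.liZeroTailLaguerre_proof (operator:999:545382)

sub-problem: RiemannHypothesis · status: closed(proved) · opened planner-rh-li-theory-g9-0 2026-08-26T16:36:29Z · rev 1 · ledger route-RiemannHypothesis-LiTailLaguerre
GENERATED by the gate from the ledger (D-0016/17). Provers cite these decls: `theorem foo : Summit.RiemannHypothesis.RiemannHypothesis.Theses.LiTailLaguerre.<Decl> := …` in Summits/RiemannHypothesis/RiemannHypothesis/Theorems/<Name>.lean.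
-/

namespace Summit.RiemannHypothesis.RiemannHypothesis.Theses.LiTailLaguerre

open scoped BigOperators Topology Manifold Classical MeasureTheory ProbabilityTheory Matrix InnerProductSpace ComplexConjugate ContinuousMap
open Filter Set Function TopologicalSpace MeasureTheory

attribute [summit_statement] _root_.Summit.RiemannHypothesis
attribute [summit_statement] _root_.Summit.RiemannHypothesis.RiemannHypothesis.Theorems.LiTheory.LiZeroTailLaguerre

open Summit

/-- item stmt-RiemannHypothesis-19702 · crux · rank 2 · closed · proved by Summit.RiemannHypothesis.RiemannHypothesis.Theorems.LiTheory.liPrimeTailLaguerre_proof (prover) · by planner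
why it might fail: the termwise pieces 2m^{−iy}, m^{−iy}F_n(w), m^{−iy}F_n(1−w) converge only conditionally at ∞ (need bounds on [T,Y] uniform in Y); and the bridge normalisation (π e^{−y/2}, index n−1) must match liLaguerreOne exactly — a factor 2 or index shift leaves an O(n^{1/4}) residual.
sources: BombieriLagarias1999, paper:arxiv-math-ph_0505052, doi:10.1016/j.jat.2006.10.006, Coffey2010Eta, Bombieri2000Weil, Gonek1993
[crux] (K2′, deciding, RH-FREE) the PRIME TAIL equals the released Laguerre terms: for every c > 0
off the resonances (log m ≠ 1/c² for prime powers m), large n and every cut T ∈ [c√n, c√n + 1],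
|liPrimeTail n T − Σ_{2 ≤ m ≤ ⌊e^{1/c²}⌋} liCoffeyTerm m n| ≤ C log n (true size O_c(1)):
liPrimeTail = (1/π) Re Σ_m Λ(m) m^{−3/2} ∫_T^∞ m^{−iy}(2 − k_n(3/2+iy)) dy (sum/integral exchanged
by absolute convergence, |2 − k_n| ≤ 3 + e^{1/c²} on [T, n], ≤ C n²/y² beyond); a RELEASED m
(finitely many) is moved by Cauchy on [½, 3/2] × [T, Y], Y → ∞, to the critical line where 2 −
k_n(½+iy) = 2(1 − cos nθ(y)) and Re ∫_0^∞ m^{−iy} 2(1 − cos nθ) dy = π m^{−1/2} L¹_{n−1}(log m) (the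
bridge — IN THE KERNEL since 15:19Z:
`Literature.Analysis.SpecialFunctions.integral_liKernel_mul_cos_Ioi`, eng-4 g4 p451181/p454135, with
`laguerreCoeff_one` for liLaguerreOne n = L^{(1)}_{n−1}; support LiLaguerreBridge is its corollary),
the connector at height T is O(m^{−1/2}(3 + e^{1/c²})) and the missing ∫_0^T is non-stationary
(phase y log m − nθ(y) has derivative ≤ −(n/(T² + ¼) − log m) < −gap_c on [0, T]); a NON-RELEASED m
stays on Re w = 3/2 where all three phases y log m, y log m ∓ arg F_n are monotone with |φ′| -/
@[route_item "route-RiemannHypothesis-LiTailLaguerre", crux]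
def LiPrimeTailLaguerre : Prop :=
  ∀ c : ℝ, 0 < c → (∀ m : ℕ, 2 ≤ m → (ArithmeticFunction.vonMangoldt m : ℝ) ≠ 0 → Real.log m ≠ 1 / c ^ 2) → ∃ N : ℕ, ∃ C : ℝ, ∀ n : ℕ, N ≤ n → ∀ T : ℝ, c * Real.sqrt n ≤ T → T ≤ c * Real.sqrt n + 1 → |Summit.RiemannHypothesis.RiemannHypothesis.Theorems.LiTheory.liPrimeTail n T - ∑ m ∈ Finset.Icc 2 ⌊Real.exp (1 / c ^ 2)⌋₊, Summit.RiemannHypothesis.RiemannHypothesis.Theorems.LiTheory.liCoffeyTerm m n| ≤ C * Real.log n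

-- `LiPrimeTailLaguerre` holds: proved by `Summit.RiemannHypothesis.RiemannHypothesis.Theorems.LiTheory.liPrimeTailLaguerre_proof` (its module imports this route file, so no `_holds` link can be stated here).

/-- item stmt-RiemannHypothesis-19703 · crux · rank 3 · closed · proved by Summit.RiemannHypothesis.RiemannHypothesis.Theorems.LiTheory.liTailContour_proof (prover) · by planner
why it might fail: the Y → ∞ passage needs dominated convergence for three Ioi-integrals whose co-weight decays only beyond y ≍ n (O(1) on [T, n]), good heights Y_k → ∞, and the finsum bookkeeping Σ m(1 − zⁿ) = Σ m − Σ m zⁿ over liZeroBox; a sign slip in liHorizTail/liPrimeTail makes it false as typed.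
sources: BombieriLagarias1999, Bombieri2000Weil, MontgomeryVaughan2007, tree:Summits/RiemannHypothesis/RiemannHypothesis/Theorems/LiPrimeEchoLiWindowContour.lean, tree:Literature/NumberTheory/LFunctions/Equivalents.lean, tree:Literature/NumberTheory/LFunctions/RiemannXiLogDeriv.lean
[crux] (K1′) the TAIL CONTOUR IDENTITY: for n ≥ 1 and a good height T ≥ 1 (no zero of ξ on [−1/2,
3/2] × {T}), liZeroTail n T = liPolarTail n T + liGammaTail n T − liPrimeTail n T + liHorizTail n T
— the PROVED window identity `LiWindowContour` (route LiPrimeEcho) at weights F_0 = 1 and F_n on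
[−1/2, 3/2] × [T, Y] for good Y → ∞: Σ_{T<|Im ρ|≤Y} Re m(1 − z_ρⁿ) = liZeroTraceWindow 0 T Y −
liZeroTraceWindow n T Y = (edges with the co-weight 2 − k_n) + liHorizTail n T − (top edge at Y);
the zero side tends to liZeroTail n T by Bombieri–Lagarias (`keiperLiCoeff_eq_zero_sum_holds`), the
top edge is O(n log² Y / Y) → 0 along good heights (|1 − F_n(x + iY)| ≤ e n/Y for Y ≥ n, ∫|ξ′/ξ| dx
≤ C log² Y at a good height), and the three right-edge integrals converge absolutely (co-weight
O(n²/y²) beyond y ≍ n against 2/y, ½ log y, ζ′/ζ(3/2)). [difficulty: M] -/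
@[route_item "route-RiemannHypothesis-LiTailLaguerre", crux]
def LiTailContour : Prop :=
  ∀ (n : ℕ) (T : ℝ), 1 ≤ n → 1 ≤ T → T ∈ Summit.RiemannHypothesis.RiemannHypothesis.Theorems.LiTheory.liGoodHeights → Summit.RiemannHypothesis.RiemannHypothesis.Theorems.LiTheory.liZeroTail n T = Summit.RiemannHypothesis.RiemannHypothesis.Theorems.LiTheory.liPolarTail n T + Summit.RiemannHypothesis.RiemannHypothesis.Theorems.LiTheory.liGammaTail n T - Summit.RiemannHypothesis.RiemannHypothesis.Theorems.LiTheory.liPrimeTail n T + Summit.RiemannHypothesis.RiemannHypothesis.Theorems.LiTheory.liHorizTail n T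

-- `LiTailContour` holds: proved by `Summit.RiemannHypothesis.RiemannHypothesis.Theorems.LiTheory.liTailContour_proof` (its module imports this route file, so no `_holds` link can be stated here).

/-- item stmt-RiemannHypothesis-19704 · crux · rank 4 · closed · proved by Summit.RiemannHypothesis.RiemannHypothesis.Theorems.LiTheory.liGammaTailShift_proof (prover) · by planner
why it might fail: low risk; the critical-line identifications are the PROVED ones of LiGammaShift; new is the unbounded strip: integrability of ψ(w/2)(2 − k_n) ~ log y·n²/y² on Ioi T on both lines and the vanishing top connector — an O(1/y) co-weight bound would NOT suffice.
sources: Bombieri2000Weil, MontgomeryVaughan2007, Titchmarsh1986, tree:Summits/RiemannHypothesis/RiemannHypothesis/Theorems/LiPrimeEchoLiGammaShift.lean, tree:Literature/NumberTheory/LFunctions/WeilExplicitRightEdge.lean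
[crux] (K3′) the GAMMA TAIL IS THE SMOOTH TAIL up to O(log n): for c > 0, large n and c√n ≤ T ≤ n,
|liGammaTail n T − liSmoothTail n T| ≤ C log n — Cauchy on [½, 3/2] × [T, Y] for the analytic
integrand (−½ log π + ½ψ(w/2))(2 − k_n(w)) (no pole above height 1), Y → ∞ (top connector O(n² log
Y/Y²)); on the critical line 2 − k_n(½ + it) = 2(1 − cos nθ(t)) (|1 − 1/s| = 1, arg(1 − 1/s) = 2
arctan(1/2t) = liZeroAngle t) and Re(−½ log π + ½ψ(¼ + it/2)) = liGammaDensity t, so the shifted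
integral IS liSmoothTail n T exactly; the connector at height T costs ≤ (½ log(T + 4) + 5)(3 +
e^{1/c²}) = O(log n) (`norm_digamma_le_log_height`, |F_n(w)| ≤ 1 and |F_n(1 − w)| ≤ e^{n/T²} ≤
e^{1/c²} for Re w ≥ ½, Im w ≥ c√n).  A near-copy of the PROVED `LiGammaShift`. [difficulty: M] -/
@[route_item "route-RiemannHypothesis-LiTailLaguerre", crux]
def LiGammaTailShift : Prop :=
  ∀ c : ℝ, 0 < c → ∃ N : ℕ, ∃ C : ℝ, ∀ n : ℕ, N ≤ n → ∀ T : ℝ, c * Real.sqrt n ≤ T → T ≤ n → |Summit.RiemannHypothesis.RiemannHypothesis.Theorems.LiTheory.liGammaTail n T - Summit.RiemannHypothesis.RiemannHypothesis.Theorems.LiTheory.liSmoothTail n T| ≤ C * Real.log n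

-- `LiGammaTailShift` holds: proved by `Summit.RiemannHypothesis.RiemannHypothesis.Theorems.LiTheory.liGammaTailShift_proof` (its module imports this route file, so no `_holds` link can be stated here).

/-- item stmt-RiemannHypothesis-19705 · crux · rank 5 · closed · proved by Summit.RiemannHypothesis.RiemannHypothesis.Theorems.LiTheory.liTailHorizontal_proof (prover) · by planner
why it might fail: low risk — inputs are tree theorems; residual work is the interval-integrability of σ ↦ ξ′/ξ(σ + iT′)(1 − F_n(σ + iT′)) on the closed segment at a good height and the weight bound for σ < 0 (|1 − 1/s|² ≤ 1 + 2/T′² needs σ ≥ −1/2).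
sources: MontgomeryVaughan2007, Bombieri2000Weil, tree:Summits/RiemannHypothesis/RiemannHypothesis/Theorems/LiPrimeEchoLiHorizontalEdges.lean, tree:Literature/NumberTheory/LFunctions/ExplicitFormulaPsiProofs.lean, tree:Literature/NumberTheory/LFunctions/RiemannXiLogDeriv.lean
[crux] (K4′) the BOTTOM EDGE at a good height: for c > 0, large n and every T ∈ [c√n, n] there is a
good height T′ ∈ [T, T + 1] with |liHorizTail n T′| ≤ C log² n — liHorizTail n T′ = liHorizTerm 0 T′
− liHorizTerm n T′ (weights 1 and F_n), Montgomery–Vaughan Lemma 12.2 good heights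
(`ExplicitPsi.exists_goodHeight_all`: separation η with 1/η ≤ 2 + log(T′ + 2)/c₀ from every
ordinate), the segment bound |ξ′/ξ(σ + iT′)| ≤ C₀ log(|T′| + 4)/η on σ ∈ [−1/2, 3/2]
(`exists_norm_logDeriv_riemannXi_le`), |F_n(σ + iT′)| ≤ (1 + 2/T′²)^{n/2} ≤ e^{1/c²} for σ ≥ −1/2,
segment length 2.  A near-copy of the PROVED `LiHorizontalEdges` (there c ≥ 1, T ≤ c√n; here any c >
0 and T ≤ n, which only changes the constant e ↦ e^{1/c²} and log T ≤ log n). [difficulty: M] -/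
@[route_item "route-RiemannHypothesis-LiTailLaguerre", crux]
def LiTailHorizontal : Prop :=
  ∀ c : ℝ, 0 < c → ∃ N : ℕ, ∃ C : ℝ, ∀ n : ℕ, N ≤ n → ∀ T : ℝ, c * Real.sqrt n ≤ T → T ≤ n → ∃ T' : ℝ, T ≤ T' ∧ T' ≤ T + 1 ∧ T' ∈ Summit.RiemannHypothesis.RiemannHypothesis.Theorems.LiTheory.liGoodHeights ∧ |Summit.RiemannHypothesis.RiemannHypothesis.Theorems.LiTheory.liHorizTail n T'| ≤ C * Real.log n ^ 2

-- `LiTailHorizontal` holds: proved by `Summit.RiemannHypothesis.RiemannHypothesis.Theorems.LiTheory.liTailHorizontal_proof` (its module imports this route file, so no `_holds` link can be stated here).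

/-- item stmt-RiemannHypothesis-19706 · assembly · rank 1 · closed · proved by Summit.RiemannHypothesis.RiemannHypothesis.Theorems.LiTheory.liTailLaguerre_assembly_proof (prover) · by planner
sources: Bombieri2000Weil, BombieriLagarias1999, tree:Summits/RiemannHypothesis/RiemannHypothesis/Theorems/LiPrimeEchoAssembly.lean
[assembly] LiTailContour → LiPrimeTailLaguerre → LiGammaTailShift → LiTailHorizontal → the rung leaf
LiZeroTailLaguerre; provable NOW from the two RH-free support statements LiPolarTailBound (∀ c > 0,
∃ N C, ∀ n ≥ N, ∀ T ∈ [c√n, n], |liPolarTail n T| ≤ C log n) and LiTailAdjust (∀ c > 0, ∃ N C, ∀ n ≥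
N, ∀ T ∈ [c√n, c√n + 1], |liZeroTail n (c√n) − liZeroTail n T| ≤ C log n ∧ |liSmoothTail n (c√n) −
liSmoothTail n T| ≤ C log n) — composition `assembly_of_supports` kernel-checked in the sketch. -/
@[route_item "route-RiemannHypothesis-LiTailLaguerre", crux]
def Assembly : Prop :=
  LiTailContour → LiPrimeTailLaguerre → LiGammaTailShift → LiTailHorizontal → Summit.RiemannHypothesis.RiemannHypothesis.Theorems.LiTheory.LiZeroTailLaguerre

-- `Assembly` holds: proved by `Summit.RiemannHypothesis.RiemannHypothesis.Theorems.LiTheory.liTailLaguerre_assembly_proof` (its module imports this route file, so no `_holds` link can be stated here).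

/-! D-0027 §2.1 — DECIDING THEOREM (planner-authored via `route open/edit --closes-file`; by planner-rh-li-theory-g9-0 2026-08-26T16:36:29Z) — ARCHIVED: route closed (proved) 2026-08-26T20:03:50Z; kept so importers keep building:
its hypotheses are this route's items and its conclusion the registered leaf `Summit.RiemannHypothesis.RiemannHypothesis.Theorems.LiTheory.LiZeroTailLaguerre` (rung L-P(P1-tail), D-0061) (glue_lint), and it elaborates with this file. -/

-- glue.lean — DECIDING THEOREM of route LiTailLaguerre (D-0027 §2.1; D-0061 rung shape: concludes the RUNG LEAF
-- `Summit.RiemannHypothesis.RiemannHypothesis.Theorems.LiTheory.LiZeroTailLaguerre` («Li tail–Laguerre law», RH-FREE,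
-- registered closer rung L-P(P1-tail)) BY NAME).  Hypotheses = the four crux decls + the Assembly item (provable now from the
-- two support statements LiPolarTailBound, LiTailAdjust: composition `assembly_of_supports` kernel-checked in
-- HOME/theory/route/r7/Sketch.lean, farm rc 0 / 0 sorries); every binder is consumed (BC1: 5 binders, 4 open cruxes; BC6 clean).
@[closes "route-RiemannHypothesis-LiTailLaguerre"] theorem closes (h2 : LiPrimeTailLaguerre) (h3 : LiTailContour) (h4 : LiGammaTailShift) (h5 : LiTailHorizontal)
    (hA : Assembly) : Summit.RiemannHypothesis.RiemannHypothesis.Theorems.LiTheory.LiZeroTailLaguerre :=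
  hA h3 h2 h4 h5

end Summit.RiemannHypothesis.RiemannHypothesis.Theses.LiTailLaguerre
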